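import Summits.Langlands.Langlands.Theorems.ParityBlindBianchiResidualBianchiDoorMod2TwoAdicModel
import Summits.Langlands.Langlands.Theorems.ParityBlindBianchiResidualBianchiDoorMod2ReducibleSolvable
import Literature.NumberTheory.GaloisRepresentations.StableLatticeValuationRing
import Literature.NumberTheory.GaloisRepresentations.ReductionKernelTorsion
import Literature.NumberTheory.GaloisRepresentations.ResidualGaloisRep
import Mathlib.NumberTheory.Padics.Complex
import Mathlib.RingTheory.Valuation.Integral
import HarnessLib

/-!
# Stub stub_residual of line Sketch (crux stmt-Langlands-15112 `ParityBlindBianchi.ResidualBianchiDoorLevel`)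

Integral model over `ℤ̄₂ = 𝒪[ℚ̄₂]`, reduction and irreducibility of a finite-image
`σ₀ : Γ_ℚ → GL₂(ℚ̄₂)` with projective image `A₅`, along an abstract reduction map
`red : ℤ̄₂ → k` with kernel `𝔪 = {‖x‖ < 1}` (`k` a discrete field).

* `projGenLinGroup_map_injective_of_injective` — `PGL₂(f)` is injective for `f` injective;
* `projGenLinGroup_eq_one_of_map_eq_one` — an element of `ker (PGL₂(O) → PGL₂(k))` (`O` local,
  `f : O → k` a local homomorphism to a field) of finite order invertible in `O` is trivial
  (the tree's `projGenLinGroup_eq_one_of_pow_eq_one`, `f` factored through the residue field);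
* `injOn_projGenLinGroup_map_of_mulEquiv_alternatingGroup` — such a reduction is injective on
  every subgroup `H ≅ A₅` of `PGL₂(O)` as soon as `3 ∈ Oˣ` (the kernel is normal in the simple
  group `H` and misses the elements of order `3`);
* `isIcosahedralType_map_comp`, `isIrreducible_toStdRepresentation_map_comp` — the reduction of
  a projectively icosahedral `ρ₀ : G → GL₂(O)` is projectively icosahedral, hence irreducible
  (a reducible `GL₂(k)`-valued representation has solvable image,
  `isSolvable_range_of_not_isIrreducible`);
* `isIcosahedralType_of_map_subtype_eq` — an integral model of a projectively icosahedral
  representation is projectively icosahedral;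
* `stub_residual` — the registered stub.
-/

noncomputable section

open scoped MatrixGroups Polynomial Valued NNReal
open Polynomial Literature.NumberTheory.GaloisRepresentations
  Literature.NumberTheory.GaloisRepresentations.LocalRingReduction
  Summit.Langlands.Langlands.Theorems.ResidualBianchiDoorMod2

namespace Summit.Langlands.Langlands.Cruxes.ResidualBianchiDoorLevel.Sketch

set_option linter.dupNamespace false

/-! ### Group theory: reduction of projectively icosahedral subgroups of `GL₂(O)` -/

section GroupTheory

variable {R S : Type*} [CommRing R] [CommRing S] {G : Type*} [Group G]

/-- `GL_n(f)` is injective for an injective ring homomorphism `f`. [folklore] -/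
theorem generalLinearGroup_map_injective_of_injective {n : Type*} [Fintype n] [DecidableEq n]
    (f : R →+* S) (hf : Function.Injective f) :
    Function.Injective (Matrix.GeneralLinearGroup.map (n := n) f) := by
  intro A B h
  refine Units.ext (Matrix.ext fun i j => hf ?_)
  have hij := congrArg (fun M : GL n S => (M : Matrix n n S) i j) h
  simpa [Matrix.GeneralLinearGroup.map] using hij

/-- `PGL₂(f)` is injective for an injective ring homomorphism `f` (a matrix which becomes scalar
after applying `f` entrywise is scalar). [folklore] -/
theorem projGenLinGroup_map_injective_of_injective (f : R →+* S) (hf : Function.Injective f) :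
    Function.Injective (Matrix.ProjGenLinGroup.map (n := Fin 2) f) := by
  rw [← MonoidHom.ker_eq_bot_iff, Subgroup.eq_bot_iff_forall]
  intro x hx
  rw [MonoidHom.mem_ker] at hx
  induction x using Matrix.ProjGenLinGroup.induction_on with
  | mk g =>
    rw [Matrix.ProjGenLinGroup.map_mk, Matrix.ProjGenLinGroup.mk_eq_one,
      Matrix.GeneralLinearGroup.mem_center_iff_val_mem_range_scalar] at hx
    obtain ⟨c, hc⟩ := hx
    have hij : ∀ i j : Fin 2, f ((g : Matrix (Fin 2) (Fin 2) R) i j) =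
        (Matrix.scalar (Fin 2) c) i j := fun i j => by
      rw [hc]
      rfl
    rw [Matrix.ProjGenLinGroup.mk_eq_one,
      Matrix.GeneralLinearGroup.mem_center_iff_val_mem_range_scalar]
    refine ⟨(g : Matrix (Fin 2) (Fin 2) R) 0 0, ?_⟩
    have h01 : (g : Matrix (Fin 2) (Fin 2) R) 0 1 = 0 := hf (by rw [hij, map_zero]; simp)
    have h10 : (g : Matrix (Fin 2) (Fin 2) R) 1 0 = 0 := hf (by rw [hij, map_zero]; simp)
    have h11 : (g : Matrix (Fin 2) (Fin 2) R) 0 0 = (g : Matrix (Fin 2) (Fin 2) R) 1 1 :=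
      hf (by rw [hij, hij]; simp)
    ext i j
    fin_cases i <;> fin_cases j <;> simp [h01, h10, h11]

variable [IsLocalRing R] {k : Type*} [Field k]

/-- **Kernel lemma along a local homomorphism to a field.**  Let `O` be local, `f : O → k` a
local ring homomorphism to a field (i.e. `ker f = 𝔪`), and `x ∈ PGL₂(O)` with `PGL₂(f) x = 1`
and `x ^ m = 1` for some `m` invertible in `O`.  Then `x = 1`: `f` factors as an injection of the
residue field after `residue`, and the tree's `projGenLinGroup_eq_one_of_pow_eq_one` applies.
[folklore] -/
theorem projGenLinGroup_eq_one_of_map_eq_one (f : R →+* k) [IsLocalHom f] {x : PGL(Fin 2, R)}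
    (hx : Matrix.ProjGenLinGroup.map f x = 1) {m : ℕ} (hm : IsUnit (m : R)) (hpow : x ^ m = 1) :
    x = 1 := by
  have hf : f = (IsLocalRing.ResidueField.lift f).comp (IsLocalRing.residue R) :=
    (IsLocalRing.ResidueField.lift_comp_residue f).symm
  have h1 : Matrix.ProjGenLinGroup.map (IsLocalRing.residue R) x = 1 := by
    apply projGenLinGroup_map_injective_of_injective (IsLocalRing.ResidueField.lift f)
      (RingHom.injective _)
    rw [map_one, ← MonoidHom.comp_apply, ← Matrix.ProjGenLinGroup.map_comp, ← hf, hx]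
  exact projGenLinGroup_eq_one_of_pow_eq_one h1 hm hpow

/-- `A₅` has a non-trivial element of order `3` (a `3`-cycle). [folklore] -/
theorem exists_ne_one_pow_three_alternatingGroup_fin_five :
    ∃ g : alternatingGroup (Fin 5), g ≠ 1 ∧ g ^ 3 = 1 := by
  decide

/-- **Reduction along a local homomorphism is injective on icosahedral subgroups of `PGL₂(O)`
when `3 ∈ Oˣ`.**  The kernel of `PGL₂(f)|_H` is a normal subgroup of the simple group `H ≅ A₅`;
it is not all of `H`, since an element of order `3` in the kernel would be trivial
(`projGenLinGroup_eq_one_of_map_eq_one`); so it is trivial. [folklore] -/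
theorem injOn_projGenLinGroup_map_of_mulEquiv_alternatingGroup (f : R →+* k) [IsLocalHom f]
    (h3 : IsUnit (3 : R)) {H : Subgroup PGL(Fin 2, R)} (e : H ≃* alternatingGroup (Fin 5)) :
    Set.InjOn (Matrix.ProjGenLinGroup.map f) (H : Set PGL(Fin 2, R)) := by
  haveI : IsSimpleGroup H := isSimpleGroup_of_mulEquiv_alternatingGroup e
  set φ : H →* PGL(Fin 2, k) := (Matrix.ProjGenLinGroup.map f).comp H.subtype with hφdef
  have hφ : ∀ x : H, φ x = Matrix.ProjGenLinGroup.map f (x : PGL(Fin 2, R)) := fun _ => rfl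
  rcases Subgroup.Normal.eq_bot_or_eq_top (inferInstance : φ.ker.Normal) with hbot | htop
  · intro x hx y hy hxy
    have hinj := (MonoidHom.ker_eq_bot_iff φ).mp hbot
    have hxy' : φ ⟨x, hx⟩ = φ ⟨y, hy⟩ := by rwa [hφ, hφ]
    exact congrArg Subtype.val (hinj hxy')
  · exfalso
    obtain ⟨g, hg1, hg3⟩ := exists_ne_one_pow_three_alternatingGroup_fin_five
    have hx1 : e.symm g ≠ 1 := fun h => hg1 (by simpa using congrArg e h)
    have hx3 : ((e.symm g : H) : PGL(Fin 2, R)) ^ 3 = 1 := by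
      rw [← Subgroup.coe_pow, ← map_pow, hg3, map_one, Subgroup.coe_one]
    have hxker : φ (e.symm g) = 1 := by
      rw [← MonoidHom.mem_ker, htop]
      exact Subgroup.mem_top _
    rw [hφ] at hxker
    have h3' : IsUnit ((3 : ℕ) : R) := by exact_mod_cast h3
    exact hx1 (Subtype.ext (projGenLinGroup_eq_one_of_map_eq_one f hxker h3' hx3))

/-- **The reduction of a projectively icosahedral `ρ₀ : G → GL₂(O)` along a local homomorphism
`f : O → k` to a field is projectively icosahedral** (`3 ∈ Oˣ`): `PGL₂(f)` is injective on the
projective image (`nonempty_projectiveImage_comp_mulEquiv_of_injOn`). [folklore] -/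
theorem isIcosahedralType_map_comp (f : R →+* k) [IsLocalHom f] (h3 : IsUnit (3 : R))
    (ρ₀ : G →* GL (Fin 2) R) (hρ₀ : IsIcosahedralType ρ₀) :
    IsIcosahedralType ((Matrix.GeneralLinearGroup.map f).comp ρ₀) := by
  obtain ⟨e⟩ := hρ₀
  obtain ⟨e'⟩ := nonempty_projectiveImage_comp_mulEquiv_of_injOn f ρ₀
    (injOn_projGenLinGroup_map_of_mulEquiv_alternatingGroup f h3 e)
  exact ⟨e'.trans e⟩

/-- **The reduction of a projectively icosahedral `ρ₀ : G → GL₂(O)` is irreducible**: a reducible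
`GL₂(k)`-valued representation has solvable image (`isSolvable_range_of_not_isIrreducible`), but a
projectively icosahedral one does not (`A₅` is not solvable). [folklore] -/
theorem isIrreducible_toStdRepresentation_map_comp (f : R →+* k) [IsLocalHom f]
    (h3 : IsUnit (3 : R)) (ρ₀ : G →* GL (Fin 2) R) (hρ₀ : IsIcosahedralType ρ₀) :
    (toStdRepresentation ((Matrix.GeneralLinearGroup.map f).comp ρ₀)).IsIrreducible := by
  by_contra h
  exact (isIcosahedralType_map_comp f h3 ρ₀ hρ₀).not_isSolvable_range
    (isSolvable_range_of_not_isIrreducible _ h)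

end GroupTheory

/-! ### Integral models keep the projective image -/

section IntegralModel

variable {F : Type*} [Field F] {G : Type*} [Group G]

/-- **An integral model of a projectively icosahedral representation is projectively
icosahedral**: if `ρ₀(g) = P⁻¹ ρ(g) P` in `GL₂(F)` for all `g` (`ρ₀` valued in `GL₂(O)`,
`O ⊆ F` a subring), then `\bar ρ₀(G) ≅ \bar ρ(G)`, since `PGL₂(O) → PGL₂(F)` is injective and
conjugation by `P` is an automorphism of `PGL₂(F)`. [folklore] -/
theorem isIcosahedralType_of_map_subtype_eq (O : Subring F) (ρ : G →* GL (Fin 2) F)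
    (ρ₀ : G →* GL (Fin 2) O) (P : GL (Fin 2) F)
    (h : ∀ g, Matrix.GeneralLinearGroup.map O.subtype (ρ₀ g) = P⁻¹ * ρ g * P)
    (hρ : IsIcosahedralType ρ) : IsIcosahedralType ρ₀ := by
  have heq : (Matrix.GeneralLinearGroup.map O.subtype).comp ρ₀ = conjGL P⁻¹ ρ := by
    ext1 g
    rw [MonoidHom.comp_apply, h g, conjGL_apply, inv_inv]
  obtain ⟨e⟩ := hρ
  obtain ⟨e'⟩ := nonempty_projectiveImage_comp_mulEquiv_of_injOn O.subtype ρ₀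
    (projGenLinGroup_map_injective_of_injective O.subtype (fun _ _ hxy => Subtype.ext hxy)).injOn
  rw [heq] at e'
  exact ⟨e'.symm.trans ((projectiveImageConjEquiv P⁻¹ ρ).symm.trans e)⟩

/-- The characteristic polynomial of an integral model maps to that of `ρ`:
`charpoly(ρ₀ g) ↦ charpoly(P⁻¹ ρ(g) P) = charpoly(ρ g)` (the tree's `charpoly_integralModel`,
for a subring). [folklore] -/
theorem charpoly_map_subtype_of_map_subtype_eq (O : Subring F) (ρ : G →* GL (Fin 2) F)
    (ρ₀ : G →* GL (Fin 2) O) (P : GL (Fin 2) F)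
    (h : ∀ g, Matrix.GeneralLinearGroup.map O.subtype (ρ₀ g) = P⁻¹ * ρ g * P) (g : G) :
    ((ρ₀ g : GL (Fin 2) O) : Matrix (Fin 2) (Fin 2) O).charpoly.map O.subtype =
      ((ρ g : GL (Fin 2) F) : Matrix (Fin 2) (Fin 2) F).charpoly := by
  rw [← Matrix.charpoly_map]
  have h1 : ((ρ₀ g : GL (Fin 2) O) : Matrix (Fin 2) (Fin 2) O).map O.subtype =
      ((Matrix.GeneralLinearGroup.map O.subtype (ρ₀ g) : GL (Fin 2) F) :
        Matrix (Fin 2) (Fin 2) F) := rfl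
  rw [h1, h, Units.val_mul, Units.val_mul, Matrix.coe_units_inv]
  exact Matrix.charpoly_units_conj' P _

/-- A monic polynomial of degree `2` over an algebraically closed field is `(X - a)(X - b)`.
[folklore] -/
theorem exists_eq_X_sub_C_mul_X_sub_C [IsAlgClosed F] {p : Polynomial F} (hp : p.Monic)
    (hdeg : p.natDegree = 2) : ∃ a b : F, p = (X - C a) * (X - C b) := by
  have hsplit : p.Splits := IsAlgClosed.splits p
  have hprod := hsplit.eq_prod_roots_of_monic hp
  have hcard : p.roots.card = 2 := by rw [← hsplit.natDegree_eq_card_roots, hdeg]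
  obtain ⟨a, b, hab⟩ := Multiset.card_eq_two.mp hcard
  refine ⟨a, b, ?_⟩
  rw [hprod, hab]
  simp

end IntegralModel

/-! ### The `2`-adic case -/

section TwoAdic

/-- `3` is a unit of `ℤ̄₂ = 𝒪[ℚ̄₂]`: `|3|₂ = |1 + 2|₂ = 1` since `|2|₂ < 1`. [folklore] -/
theorem isUnit_three_integer_padicAlgCl_two : IsUnit (3 : 𝒪[PadicAlgCl 2]) := by
  rw [Valuation.Integers.isUnit_iff_valuation_eq_one (Valuation.integer.integers _)]
  have h := PadicAlgCl.valuation_p 2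
  simp only [Nat.cast_ofNat] at h
  have h2 : Valued.v (2 : PadicAlgCl 2) < 1 := by rw [h]; norm_num
  have h3 : (algebraMap 𝒪[PadicAlgCl 2] (PadicAlgCl 2)) 3 = 1 + 2 := by
    rw [map_ofNat]; norm_num
  rw [h3]
  exact Valuation.map_one_add_of_lt _ h2

/-- In `ℤ̄_p = 𝒪[ℚ̄_p]`, the non-units are the elements of norm `< 1`. [folklore] -/
theorem not_isUnit_integer_padicAlgCl_iff {p : ℕ} [Fact p.Prime] (x : 𝒪[PadicAlgCl p]) :
    ¬ IsUnit x ↔ ‖(x : PadicAlgCl p)‖ < 1 := by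
  rw [Valuation.Integer.not_isUnit_iff_valuation_lt_one, PadicAlgCl.valuation_def,
    ← NNReal.coe_lt_coe, coe_nnnorm]
  simp

/-- A ring homomorphism `red : ℤ̄_p → k` to a field with `red x = 0 ↔ ‖x‖ < 1` is a local
homomorphism (its kernel is the maximal ideal). [folklore] -/
theorem isLocalHom_of_apply_eq_zero_iff {p : ℕ} [Fact p.Prime] {k : Type*} [Field k]
    (red : 𝒪[PadicAlgCl p] →+* k)
    (hred : ∀ x : 𝒪[PadicAlgCl p], red x = 0 ↔ ‖(x : PadicAlgCl p)‖ < 1) :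
    IsLocalHom red := by
  refine ⟨fun x hx => ?_⟩
  by_contra hnu
  exact hx.ne_zero ((hred x).mpr ((not_isUnit_integer_padicAlgCl_iff x).mp hnu))

/-- Roots in `ℚ̄_p` of a monic polynomial with coefficients in `ℤ̄_p` have norm `≤ 1`
(`ℤ̄_p` is integrally closed in `ℚ̄_p`, Mathlib `Valuation.Integers.isIntegral_iff_v_le_one`).
[folklore] -/
theorem norm_le_one_of_isRoot_map {p : ℕ} [Fact p.Prime] {P : Polynomial 𝒪[PadicAlgCl p]}
    (hP : P.Monic) {a : PadicAlgCl p} (ha : (P.map (𝒪[PadicAlgCl p]).subtype).IsRoot a) :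
    ‖a‖ ≤ 1 := by
  have hint : IsIntegral 𝒪[PadicAlgCl p] a := ⟨P, hP, by rwa [← Polynomial.eval_map]⟩
  have h := (Valuation.Integers.isIntegral_iff_v_le_one (Valuation.integer.integers
    (Valued.v : Valuation (PadicAlgCl p) ℝ≥0))).mp hint
  rw [PadicAlgCl.valuation_def] at h
  exact_mod_cast h

/-- **Stub `stub_residual` (integral model, reduction, irreducibility).**  Let
`σ₀ : Γ_ℚ → GL₂(ℚ̄₂)` be continuous with finite image and projective image `≅ A₅`, `k` a discrete
field and `red : ℤ̄₂ → k` a ring homomorphism with kernel `𝔪 = {‖x‖ < 1}`.  Conjugating into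
`GL₂(ℤ̄₂)` (`exists_integralModel_of_valuationSubring`, `ℤ̄₂` open) and reducing along `red` gives
a continuous (open kernel: it contains the open `ker σ₀`) `σ̄ : Γ_ℚ → GL₂(k)` such that for every
`g`, `charpoly σ₀(g) = P_g ∈ ℤ̄₂[X]` (`P_g = charpoly ρ₀(g)` for the integral model `ρ₀`) splits
as `(X - a)(X - b)` with `a, b ∈ ℤ̄₂` (`ℤ̄₂` is integrally closed in `ℚ̄₂`) and
`charpoly σ̄(g) = red(P_g)`.  `σ̄` is IRREDUCIBLE: a reducible `σ̄` has solvable image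
(`isSolvable_range_of_not_isIrreducible`), but the projective image of `σ̄` is still `≅ A₅` —
the kernel of `PGL₂(ℤ̄₂) → PGL₂(k)` meets the `A₅` in a normal subgroup without elements of
order `3` (`projGenLinGroup_eq_one_of_pow_eq_one`, `3 ∈ ℤ̄₂ˣ`), hence trivially — and `A₅` is
not solvable.  Serre, *Abelian ℓ-adic representations* (1968), Ch. I §1.1 (integral models);
Darmon–Diamond–Taylor (1995), §2.1 (reduction). [folklore] -/
theorem stub_residual {k : Type} [Field k] [TopologicalSpace k] [DiscreteTopology k]
    (red : 𝒪[PadicAlgCl 2] →+* k) (hred : ∀ x : 𝒪[PadicAlgCl 2], red x = 0 ↔ ‖(x : PadicAlgCl 2)‖ < 1)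
    (σ₀ : FramedGaloisRep ℚ (PadicAlgCl 2) 2) (hfin : Finite σ₀.toMonoidHom.range)
    (hA5 : Nonempty (projectiveImage σ₀.toMonoidHom ≃* alternatingGroup (Fin 5))) :
    ∃ σbar : FramedGaloisRep ℚ k 2, σbar.toGaloisRep.IsIrreducible ∧
      ∀ g : Field.absoluteGaloisGroup ℚ, ∃ (P : Polynomial 𝒪[PadicAlgCl 2]) (a b : PadicAlgCl 2),
        ‖a‖ ≤ 1 ∧ ‖b‖ ≤ 1 ∧ P.map (𝒪[PadicAlgCl 2]).subtype = (X - C a) * (X - C b) ∧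
        ((σ₀ g : GL (Fin 2) (PadicAlgCl 2)) : Matrix (Fin 2) (Fin 2) (PadicAlgCl 2)).charpoly =
          P.map (𝒪[PadicAlgCl 2]).subtype ∧
        ((σbar g : GL (Fin 2) k) : Matrix (Fin 2) (Fin 2) k).charpoly = P.map red := by
  -- (a) integral model over the open valuation ring `ℤ̄₂`
  have hOopen : IsOpen ((padicAlgClIntegers 2 : ValuationSubring (PadicAlgCl 2)) :
      Set (PadicAlgCl 2)) := Valued.isOpen_valuationSubring _
  obtain ⟨P, ρ₀, hρ₀⟩ : ∃ (P : GL (Fin 2) (PadicAlgCl 2))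
      (ρ₀ : Field.absoluteGaloisGroup ℚ →* GL (Fin 2) 𝒪[PadicAlgCl 2]),
      ∀ g, Matrix.GeneralLinearGroup.map (𝒪[PadicAlgCl 2]).subtype (ρ₀ g) = P⁻¹ * σ₀ g * P :=
    exists_integralModel_of_valuationSubring (O := padicAlgClIntegers 2) hOopen σ₀
  -- (b) the reduction `σ̄ = red ∘ ρ₀`, continuous since its kernel contains the open `ker σ₀`
  set φ : Field.absoluteGaloisGroup ℚ →* GL (Fin 2) k :=
    (Matrix.GeneralLinearGroup.map red).comp ρ₀ with hφdef
  have hker : IsOpen (φ.ker : Set (Field.absoluteGaloisGroup ℚ)) := by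
    haveI := hfin
    refine Subgroup.isOpen_mono ?_ (isOpen_ker_of_finite_range σ₀)
    intro g hg
    rw [MonoidHom.mem_ker] at hg ⊢
    have hg' : σ₀ g = 1 := hg
    have h1 : ρ₀ g = 1 := by
      apply generalLinearGroup_map_injective_of_injective (𝒪[PadicAlgCl 2]).subtype
        (fun _ _ hxy => Subtype.ext hxy)
      rw [hρ₀ g, map_one, hg', mul_one, inv_mul_cancel]
    rw [hφdef, MonoidHom.comp_apply, h1, map_one]
  let σbar : FramedGaloisRep ℚ k 2 :=
    { φ with continuous_toFun :=
        Literature.NumberTheory.Automorphic.MonoidHom.continuous_of_isOpen_ker φ hker }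
  have hσbar : ∀ g, σbar g = φ g := fun _ => rfl
  refine ⟨σbar, ?_, fun g => ?_⟩
  · -- (d) irreducibility
    haveI : IsLocalHom red := isLocalHom_of_apply_eq_zero_iff red hred
    exact isIrreducible_toStdRepresentation_map_comp red isUnit_three_integer_padicAlgCl_two ρ₀
      (isIcosahedralType_of_map_subtype_eq _ σ₀.toMonoidHom ρ₀ P hρ₀ hA5)
  · -- (c) characteristic polynomials
    set P₀ : Polynomial 𝒪[PadicAlgCl 2] :=
      ((ρ₀ g : GL (Fin 2) 𝒪[PadicAlgCl 2]) : Matrix (Fin 2) (Fin 2) 𝒪[PadicAlgCl 2]).charpoly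
      with hP₀def
    have hP₀ : P₀.map (𝒪[PadicAlgCl 2]).subtype =
        ((σ₀ g : GL (Fin 2) (PadicAlgCl 2)) : Matrix (Fin 2) (Fin 2) (PadicAlgCl 2)).charpoly :=
      charpoly_map_subtype_of_map_subtype_eq _ σ₀.toMonoidHom ρ₀ P hρ₀ g
    have hmonic : (P₀.map (𝒪[PadicAlgCl 2]).subtype).Monic := by
      rw [hP₀]; exact Matrix.charpoly_monic _
    have hdeg : (P₀.map (𝒪[PadicAlgCl 2]).subtype).natDegree = 2 := by
      rw [hP₀, Matrix.charpoly_natDegree_eq_dim, Fintype.card_fin]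
    obtain ⟨a, b, hab⟩ := exists_eq_X_sub_C_mul_X_sub_C hmonic hdeg
    have hP₀monic : P₀.Monic := Matrix.charpoly_monic _
    have ha : ‖a‖ ≤ 1 := norm_le_one_of_isRoot_map hP₀monic (by rw [hab]; simp)
    have hb : ‖b‖ ≤ 1 := norm_le_one_of_isRoot_map hP₀monic (by rw [hab]; simp)
    refine ⟨P₀, a, b, ha, hb, hab, hP₀.symm, ?_⟩
    rw [hσbar, hP₀def, ← Matrix.charpoly_map]
    rfl

end TwoAdic

end Summit.Langlands.Langlands.Cruxes.ResidualBianchiDoorLevel.Sketch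

end
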